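import Summits.HodgeConjecture.HodgeConjecture.Theorems.SignSymmetricPowersOrbitDataMono
import Literature.AlgebraicGeometry.HodgeTheory.SignSymmetricOneSeedHodgeGroup
import HarnessLib

/-!
# Crux K1-B on the `M`-supported family itself: the sign-pencil ENVELOPE with its witness EXPOSED and the KERNEL from
# `Mon⁰ ⊆ MT` at ONE point (route `SignSymmetricPowers`, stmt-HodgeConjecture-19716; programme PENCIL-B of seat prover-Ax g15)

Prover seat `hodge-nonav-prover-Ax` (g15), cell `hodge-nonav`; helper `--supports stmt-HodgeConjecture-19716`; sorry-free, no
definition, no new named fact.  The registry chain `…OrbitDataMono` ⟶ `…FourFactsMono` proves the envelope of Theorem A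
EXISTENTIALLY in the family (`∃ 𝒳 S u …`) and then consumes the Cattani–Deligne–Kaplan cover (binder hCDK) to reach a
Hodge-generic point.  For the PENCIL reading (a″)-B (planner p3 g35, 2026-08-29) the family must be the NAMED one — the
universal family `familyM ℂ 3 d M_ι` of smooth ι-even quinary forms — so that an algebraic pencil `𝔸¹ ⊇ P ⟶ S_{M_ι}`
(`Literature/…/MonomialSupportedLinearPencil`) can be pulled back along it, and the kernel must start from the pointwise
input `(Γ^Zar)⁰ ⊆ MT` at the classifying point of ONE member (which the pencil supplies by Zariski + Deligne over a curve,
WITHOUT hCDK).  This file is that re-cut; the mathematics is the registry's, verbatim: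

* `signPencilOrbitData_mono_familyM` — `SignSymmetricPowersOrbitDataMono.signPencilOrbitData_mono` with the witness
  `(totalM, baseM, familyM ℂ 3 d M_ι, …, classifyingPoint t₀)` exposed instead of `∃ (𝒳 S u … pt)` (same proof; the
  ALG clause, needed only for hCDK, is dropped);
* `signPencilEnvelope_mono_familyM` — `signPencilEnvelope_mono` likewise;
* **`signModel_of_identityComponent_le_mumfordTate`** — THE KERNEL: for `d` even `≥ 4` there are Hodge models `A` and a
  base point `t₀` such that for every smooth ι-even `f` whose classifying point `t = [f] ∈ S_{M_ι}(ℂ)` satisfies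
  `(Γ_t^Zar)⁰ ⊆ MT(H³(𝒴_t))` (`Γ_t` the monodromy group of `familyM` at `t`), the model `X_f = V₊(f)` with
  `σ = diagonalAut f` has the sign-deck properties (i)–(iii) and ALL commutators of σ-commuting cup-isometries of
  `H³(X_f;ℚ)` in the Hodge group — the body of `SignSymmetricPowersFourFactsSolo.veryGeneralSignCommutatorsInHg_of_signDeckHodge_solo`
  from the line `hΓ` on (W-ELIM algebra `commutator_mem_hodgeGroup_of_signSymmetric_of_eigenCentres`).

CONDITIONAL on the keyed binder hN′ (`stub_a3NonCommOdd`, registry v25k) through `hNC`; the deck Hodge numbers enter as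
the hypothesis `hSDH` (discharged in the tree by `signDeckHodge_of_genusBound stub_genusBoundThreefold`).  Nothing here says
HC ∕ HC_AV is proved; rung F-H1 not moved; items 19716 ∕ 19715 stay OPEN.

## References

* [VoisinHodgeII2003] C. Voisin, Hodge Theory and Complex Algebraic Geometry II, §3.2.1 Thm. 3.16, §3.2.2, §6.1.3 Cor. 6.12, §6.2.1.
* [Deligne1980] P. Deligne, La conjecture de Weil II, §4.4 (4.4.1)–(4.4.4^α).
* [CarlsonMullerStachPeters2017] J. Carlson, S. Müller-Stach, C. Peters, Period Mappings and Period Domains (2nd ed.),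
  Lemma–Definition 15.3.7.
* [Shioda1979HodgeFermat] T. Shioda, The Hodge conjecture for Fermat varieties, Math. Ann. 245 (1979), §1.
-/

noncomputable section

set_option linter.dupNamespace false
set_option linter.unusedVariables false
set_option maxHeartbeats 800000

namespace Summit.HodgeConjecture.HodgeConjecture.Theorems.SignSymmetricPowersPencilKernel

open Finset MvPolynomial CategoryTheory
open Literature.AlgebraicGeometry.Motives Literature.AlgebraicGeometry.HodgeTheory
open Literature.AlgebraicGeometry.HodgeTheory.BettiUniverse
open Literature.AlgebraicTopology.SingularHomology
open Summit.HodgeConjecture.HodgeConjecture.Theorems.SignSymmetricPowersConfluenceLinkG (isSupportedOn_of_coeff_odd_eq_zero)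
open Summit.HodgeConjecture.HodgeConjecture.Theorems.SignSymmetricPowersPencilOrbitData
open Summit.HodgeConjecture.HodgeConjecture.Theorems.SignSymmetricPowersSevenFacts
open Summit.HodgeConjecture.HodgeConjecture.Theorems.SignSymmetricPowersFourFactsGeometricGenus
open Summit.HodgeConjecture.HodgeConjecture.Theorems.SignSymmetricPowersSignFermatCount
open Summit.HodgeConjecture.HodgeConjecture.Theorems.SignSymmetricPowersSignEigenHodgeOfGeometricGenus
open Summit.HodgeConjecture.HodgeConjecture.Theorems.SignSymmetricPowersOrbitDataExchange (exists_signEigenvector)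

/-! ### §1 The GEO statement on `familyM ℂ 3 d M_ι` with its base point exposed -/

open Literature.AlgebraicGeometry.Motives Literature.AlgebraicGeometry.Motives.UniversalHypersurface Literature.AlgebraicGeometry.HodgeTheory Literature.AlgebraicGeometry.HodgeTheory.UniversalHypersurface Literature.AlgebraicGeometry.HodgeTheory.BettiUniverse CategoryTheory.Limits in
/-- **The GEO statement with unsigned fixed centres ON THE NAMED FAMILY** `familyM ℂ 3 d M_ι` (`M_ι` the ι-even quinary
monomials of degree `d`), Hodge models `A` and base point `t₀` exposed, `pt = classifyingPoint t₀`: verbatim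
`SignSymmetricPowersOrbitDataMono.signPencilOrbitData_mono` (same proof), minus the ALG clause.
[cite: VoisinHodgeII2003, §3.2.1 Thm. 3.16 and §6.2.1] [cite: Deligne1980, §4.4 (4.4.1)–(4.4.4^α)] -/
theorem signPencilOrbitData_mono_familyM (hNC : ∀ (n d : ℕ) (f₁ g₀ g₂ : MvPolynomial (Fin (n + 2)) ℂ) (j k : Fin (n + 2)) (a : Fin (n + 2) → ℂˣ),
      1 ≤ n → 1 ≤ d → Odd n → (∃ (i : Fin (n + 2)) (c : ℂ), g₀ = c • MvPolynomial.X i ^ d) →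
      f₁.IsHomogeneous d → g₀.IsHomogeneous d → g₂.IsHomogeneous d → Literature.AlgebraicGeometry.HodgeTheory.IsSymmetricA3Datum f₁ g₀ g₂ j k a →
      ∀ (εa εb : ℝ) (ψ : ℂ → ℂ), Literature.AlgebraicGeometry.HodgeTheory.IsSymmetricA3Bifurcation f₁ g₀ g₂ j a εa εb ψ →
        ∃ εa' : ℝ, 0 < εa' ∧ εa' ≤ εa ∧ Literature.AlgebraicGeometry.HodgeTheory.SymmetricA3NonCommutation n d f₁ g₀ g₂ ψ εa')
    (hMC : Literature.AlgebraicGeometry.FundamentalGroup.affineHypersurfaceComplement_meridian_isConj)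
    (hZvK : Literature.AlgebraicGeometry.FundamentalGroup.affineHypersurfaceComplement_meridians_normalClosure_eq_top)
    (hD0 : (∀ (n d : ℕ), 2 ≤ d → ∃ Disc : MvPolynomial (Literature.AlgebraicGeometry.Motives.UniversalHypersurface.DegIndex n d) ℂ, Irreducible Disc ∧ Disc.IsHomogeneous Disc.totalDegree ∧ 0 < Disc.totalDegree ∧ ∀ a : Literature.AlgebraicGeometry.Motives.UniversalHypersurface.DegIndex n d → ℂ, a ∈ Literature.AlgebraicGeometry.HodgeTheory.singularCoeffs n d ↔ MvPolynomial.eval a Disc = 0)) (hD1 : discriminant_localBranches_nodal) (hNodal : ∀ ⦃d : ℕ⦄, Even d → 4 ≤ d → (∃ f : MvPolynomial (Fin 5) ℂ, f.IsHomogeneous d ∧ (∀ e : Fin 5 →₀ ℕ, ¬ Even (e 0 + e 1) → f.coeff e = 0) ∧ Literature.AlgebraicGeometry.HodgeTheory.IsNodalFormWithNodes f ![(![0, 0, 0, 0, 1] : Fin 5 → ℂ)]) ∧ (∃ f : MvPolynomial (Fin 5) ℂ, f.IsHomogeneous d ∧ (∀ e : Fin 5 →₀ ℕ, ¬ Even (e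 0 + e 1) → f.coeff e = 0) ∧ Literature.AlgebraicGeometry.HodgeTheory.IsNodalFormWithNodes f ![(![1, 0, 0, 0, 0] : Fin 5 → ℂ)]) ∧ (∃ f : MvPolynomial (Fin 5) ℂ, f.IsHomogeneous d ∧ (∀ e : Fin 5 →₀ ℕ, ¬ Even (e 0 + e 1) → f.coeff e = 0) ∧ Literature.AlgebraicGeometry.HodgeTheory.IsNodalFormWithNodes f ![(![1, 0, 1, 0, 0] : Fin 5 → ℂ), ![-1, 0, 1, 0, 0]])) :
    open Literature.AlgebraicGeometry.Motives Literature.AlgebraicGeometry.HodgeTheory Literature.AlgebraicGeometry.HodgeTheory.BettiUniverse CategoryTheory.Limits in ∀ ⦃d : ℕ⦄, Even d → 4 ≤ d → ∃ (_ : IrreducibleSpace (baseM ℂ 3 d {m : DegIndex 3 d | Even (m.1 0 + m.1 1)}).left) (hu : IsSmoothProjectiveFamily (familyM ℂ 3 d {m : DegIndex 3 d | Even (m.1 0 + m.1 1)}) 3) (hU : IsCohomologicallyLocallyTrivialOn (familyM ℂ 3 d {m : DegIndex 3 d | Even (m.1 0 + m.1 1)}) (Set.univ : Set (ComplexPoints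 (baseM ℂ 3 d {m : DegIndex 3 d | Even (m.1 0 + m.1 1)})))) (A : ∀ t : ComplexPoints (baseM ℂ 3 d {m : DegIndex 3 d | Even (m.1 0 + m.1 1)}), HodgeModel 3 (fiberOver (familyM ℂ 3 d {m : DegIndex 3 d | Even (m.1 0 + m.1 1)}) t)) (hA : ∀ t, (A t).IsHodgeSymmetric) (hfin : ∀ t : ComplexPoints (baseM ℂ 3 d {m : DegIndex 3 d | Even (m.1 0 + m.1 1)}), Module.Finite ℚ (bettiCohomology (fiberOver (familyM ℂ 3 d {m : DegIndex 3 d | Even (m.1 0 + m.1 1)}) t) 3)) (t₀ : ComplexPoints (baseM ℂ 3 d {m : DegIndex 3 d | Even (m.1 0 + m.1 1)})), (∀ f : MvPolynomial (Fin 5) ℂ, f.IsHomogeneous d → (∀ e : Fin 5 →₀ ℕ, ¬ Even (e 0 + e 1) → f.coeff e = 0) → SmoothHypersurface.IsNonsingularForm ℂ f → ∀ (hXF : IsSmoothProjective 3 (SmoothHypersurface.hypersurface f)) (ha : (fun i : Fin 5 => if (i : ℕ) < 2 then (-1 : ℂˣ) else 1) ∈ diagonalStabilizer f), ∃ (φ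 : bettiCohomology (fiberOver (familyM ℂ 3 d {m : DegIndex 3 d | Even (m.1 0 + m.1 1)}) ((classifyingPoint ℂ 3 d {m : DegIndex 3 d | Even (m.1 0 + m.1 1)} t₀ f))) 3 ≃ₗ[ℚ] bettiCohomology (SmoothHypersurface.hypersurface f) 3) (B : LinearMap.BilinForm ℚ (bettiCohomology (fiberOver (familyM ℂ 3 d {m : DegIndex 3 d | Even (m.1 0 + m.1 1)}) ((classifyingPoint ℂ 3 d {m : DegIndex 3 d | Even (m.1 0 + m.1 1)} t₀ f))) 3)) (hB : B.IsAlt) (_ : B.Nondegenerate) (τ : bettiCohomology (fiberOver (familyM ℂ 3 d {m : DegIndex 3 d | Even (m.1 0 + m.1 1)}) ((classifyingPoint ℂ 3 d {m : DegIndex 3 d | Even (m.1 0 + m.1 1)} t₀ f))) 3 →ₗ[ℚ] bettiCohomology (fiberOver (familyM ℂ 3 d {m : DegIndex 3 d | Even (m.1 0 + m.1 1)}) ((classifyingPoint ℂ 3 d {m : DegIndex 3 d | Even (m.1 0 + m.1 1)} t₀ f))) 3) (_ : τ ^ 2 = 1) (rP rL δ₀ : bettiCohomology (fiberOver (familyM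 ℂ 3 d {m : DegIndex 3 d | Even (m.1 0 + m.1 1)}) ((classifyingPoint ℂ 3 d {m : DegIndex 3 d | Even (m.1 0 + m.1 1)} t₀ f))) 3) (c₁ c₂ c₃ : ℚ) (E : Set (bettiCohomology (fiberOver (familyM ℂ 3 d {m : DegIndex 3 d | Even (m.1 0 + m.1 1)}) ((classifyingPoint ℂ 3 d {m : DegIndex 3 d | Even (m.1 0 + m.1 1)} t₀ f))) 3 ≃ₗ[ℚ] bettiCohomology (fiberOver (familyM ℂ 3 d {m : DegIndex 3 d | Even (m.1 0 + m.1 1)}) ((classifyingPoint ℂ 3 d {m : DegIndex 3 d | Even (m.1 0 + m.1 1)} t₀ f))) 3)), let Γ := (haveI := hfin ((classifyingPoint ℂ 3 d {m : DegIndex 3 d | Even (m.1 0 + m.1 1)} t₀ f)); ratMonodromyGroup (familyM ℂ 3 d {m : DegIndex 3 d | Even (m.1 0 + m.1 1)}) 3 hU ⟨(classifyingPoint ℂ 3 d {m : DegIndex 3 d | Even (m.1 0 + m.1 1)} t₀ f), Set.mem_univ _⟩); Nontrivial (bettiCohomology (fiberOver (familyM ℂ 3 d {m : DegIndex 3 d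 | Even (m.1 0 + m.1 1)}) ((classifyingPoint ℂ 3 d {m : DegIndex 3 d | Even (m.1 0 + m.1 1)} t₀ f))) 3) ∧ (∀ x y, B (τ x) (τ y) = B x y) ∧ (∀ x, φ (τ x) = pull (diagonalAut f ha) 3 (φ x)) ∧ (∀ x y, B x y = tr hXF (3 + 3) (cup (SmoothHypersurface.hypersurface f) 3 3 (φ x) (φ y))) ∧ (haveI : HodgeTensorFacts.{0, 0} := hodgeTensorFacts_holds; haveI := finite hXF 3; haveI := hfin ((classifyingPoint ℂ 3 d {m : DegIndex 3 d | Even (m.1 0 + m.1 1)} t₀ f)); ∀ k : bettiCohomology (fiberOver (familyM ℂ 3 d {m : DegIndex 3 d | Even (m.1 0 + m.1 1)}) ((classifyingPoint ℂ 3 d {m : DegIndex 3 d | Even (m.1 0 + m.1 1)} t₀ f))) 3 ≃ₗ[ℚ] bettiCohomology (fiberOver (familyM ℂ 3 d {m : DegIndex 3 d | Even (m.1 0 + m.1 1)}) ((classifyingPoint ℂ 3 d {m : DegIndex 3 d | Even (m.1 0 + m.1 1)} t₀ f))) 3, k ∈ ((A ((classifyingPoint ℂ 3 d {m : DegIndex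 3 d | Even (m.1 0 + m.1 1)} t₀ f))).hodgeStructure (hu.isSmoothProjective ((classifyingPoint ℂ 3 d {m : DegIndex 3 d | Even (m.1 0 + m.1 1)} t₀ f))) (hA ((classifyingPoint ℂ 3 d {m : DegIndex 3 d | Even (m.1 0 + m.1 1)} t₀ f))) 3).hodgeGroup → (φ.symm.trans k).trans φ ∈ (hodge exists_isReal_hodgeModel_holds hXF 3).hodgeGroup) ∧ (∀ g ∈ Γ, ∀ x, g (τ x) = τ (g x)) ∧ (∀ g ∈ Γ, ∀ x y, B (g x) (g y) = B x y) ∧ (τ rP = rP ∨ τ rP = -rP) ∧ (τ rL = rL ∨ τ rL = -rL) ∧ B δ₀ (τ δ₀) = 0 ∧ c₁ ≠ 0 ∧ c₂ ≠ 0 ∧ c₃ ≠ 0 ∧ oneParamTransvectionEquiv B (hB rP) c₁ ∈ Γ ∧ oneParamTransvectionEquiv B (hB rL) c₂ ∈ Γ ∧ oneParamTransvectionEquiv B (hB δ₀) c₃ * oneParamTransvectionEquiv B (hB (τ δ₀)) c₃ ∈ Γ ∧ Γ = Subgroup.closure E ∧ (∀ e ∈ E, ∃ g ∈ Γ, e =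 g * oneParamTransvectionEquiv B (hB rP) c₁ * g⁻¹ ∨ e = g * oneParamTransvectionEquiv B (hB rL) c₂ * g⁻¹ ∨ e = g * (oneParamTransvectionEquiv B (hB δ₀) c₃ * oneParamTransvectionEquiv B (hB (τ δ₀)) c₃) * g⁻¹) ∧ (∀ x : bettiCohomology (fiberOver (familyM ℂ 3 d {m : DegIndex 3 d | Even (m.1 0 + m.1 1)}) ((classifyingPoint ℂ 3 d {m : DegIndex 3 d | Even (m.1 0 + m.1 1)} t₀ f))) 3, (∀ g ∈ Γ, g x = x) → x = 0) ∧ (∃ g ∈ Γ, B rP (g δ₀) ≠ 0) ∧ (∃ g ∈ Γ, B rL (g δ₀) ≠ 0)) := by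
  classical
  intro d hd h4d
  obtain ⟨hirr, ⟨t₀⟩, hγ, A, hA, hFIBt⟩ := Summit.HodgeConjecture.HodgeConjecture.Theorems.SignSymmetricPowersFibreCoreB.stub_signFibreCoreC hd h4d
  have hu : IsSmoothProjectiveFamily (familyM ℂ 3 d {m : DegIndex 3 d | Even (m.1 0 + m.1 1)}) 3 := isSmoothProjectiveFamily_familyM ℂ 3 d {m : DegIndex 3 d | Even (m.1 0 + m.1 1)} (by decide) (le_trans (by decide) h4d)
  refine ⟨hirr, hu, isCohomologicallyLocallyTrivialOn_familyM 3 d {m : DegIndex 3 d | Even (m.1 0 + m.1 1)} (by decide) (le_trans (by decide) h4d), A, hA,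
    fun s => finite (hu.isSmoothProjective s) 3, t₀, ?_⟩
  · intro f hf hev hJ hXF ha
    have hMf := isSupportedOn_of_coeff_odd_eq_zero (d := d) hev
    have hY : IsSmoothProjective 3 (fiberOver (familyM ℂ 3 d {m : DegIndex 3 d | Even (m.1 0 + m.1 1)}) (classifyingPoint ℂ 3 d {m : DegIndex 3 d | Even (m.1 0 + m.1 1)} t₀ f)) := hu.isSmoothProjective _
    have hF := hFIBt hγ t₀ f hf hMf hJ
    have hF := hF hXF ha
    obtain ⟨hBn, hτ2, hτB, hΓτ, hΓB, φ, hφτ, ⟨c, hc, hφB⟩, hHG⟩ := hF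
    -- no Γ-invariants: the NOINV piece at the base point (stepwise application through the `let`-telescope)
    have hN := Summit.HodgeConjecture.HodgeConjecture.Theorems.SignSymmetricPowersNoInvariantsTorus.signNoInvariants hd h4d
    have hGIC' := hN (classifyingPoint ℂ 3 d {m : DegIndex 3 d | Even (m.1 0 + m.1 1)} t₀ f)
    obtain ⟨⟨f₁, hf₁, hev₁, hn₁⟩, ⟨f₂, hf₂, hev₂, hn₂⟩, ⟨f₃, hf₃, hev₃, hn₃⟩⟩ := hNodal hd h4d
    have hM₁ := isSupportedOn_of_coeff_odd_eq_zero (d := d) hev₁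
    have hM₂ := isSupportedOn_of_coeff_odd_eq_zero (d := d) hev₂
    have hM₃ := isSupportedOn_of_coeff_odd_eq_zero (d := d) hev₃
    -- (piece applications are made stepwise: one-shot elaboration of the long `let`-telescopes times out)
    have hG := Summit.HodgeConjecture.HodgeConjecture.Theorems.SignSymmetricPowersMeridianGenerationMonomial.signMeridianGeneration_monomial hZvK hD0 hD1 hd h4d
    have hG := hG hγ t₀ f hf hMf hJ
    have hG := hG f₁ f₂ f₃
    have hG := hG hf₁ hM₁ hn₁
    have hG := hG hf₂ hM₂ hn₂
    have hG := hG hf₃ hM₃ hn₃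
    obtain ⟨g₁, g₂, g₃, hg₁X, hg₂X, hg₃X, hg₁, hMg₁, hgp₁, hg₂, hMg₂, hgp₂, hg₃, hMg₃, hgp₃, ε₁, hε₁, hGENε⟩ := hG
    have hg₁m : ∃ (i : Fin 5) (a : ℂ), g₁ = a • MvPolynomial.X i ^ d := ⟨4, 1, by rw [hg₁X, one_smul]⟩
    have hg₂m : ∃ (i : Fin 5) (a : ℂ), g₂ = a • MvPolynomial.X i ^ d := ⟨0, 1, by rw [hg₂X, one_smul]⟩
    have hg₃m : ∃ (i : Fin 5) (a : ℂ), g₃ = a • MvPolynomial.X i ^ d := ⟨2, 1, by rw [hg₃X, one_smul]⟩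
    have hP := Summit.HodgeConjecture.HodgeConjecture.Theorems.SignSymmetricPowersPencilTransvectionsSolo.signPencilTransvections_solo hd h4d
    have hP := hP hγ t₀ f hf hMf hJ
    obtain ⟨hPP, hPN, hP2⟩ := hP
    have hPP := hPP f₁ g₁ hf₁ hg₁ hg₁m
    have hPP := hPP hM₁ hMg₁ hn₁ hgp₁
    obtain ⟨εP, hεP, hPPε⟩ := hPP
    have hPN := hPN f₂ g₂ hf₂ hg₂ hg₂m
    have hPN := hPN hM₂ hMg₂ hn₂ hgp₂
    obtain ⟨εL, hεL, hPLε⟩ := hPN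
    have hP2 := hP2 f₃ g₃ hf₃ hg₃ hg₃m
    have hP2 := hP2 hM₃ hMg₃ hn₃ hgp₃
    obtain ⟨εD, hεD, hP2ε⟩ := hP2
    have hK := (Summit.HodgeConjecture.HodgeConjecture.Theorems.SignSymmetricPowersConfluenceLinkGNMono.signConfluenceLinkG_of_nonComm_mono hD0 hNC
      hMC hD1) hd h4d
    have hK := hK hγ t₀ f hf hMf hJ
    have hK := hK hτ2 hτB hΓτ hΓB
    have hK₁ := hK ![0, 0, 0, 0, 1] (Or.inl rfl) f₁ g₁ hf₁ hg₁
    have hK₁ := hK₁ hM₁ hMg₁ hn₁ hgp₁ f₃ g₃ hf₃ hg₃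
    have hK₁ := hK₁ hM₃ hMg₃ hn₃ hgp₃
    obtain ⟨εK, hεK, hKε⟩ := hK₁
    have hK₂ := hK ![1, 0, 0, 0, 0] (Or.inr rfl) f₂ g₂ hf₂ hg₂
    have hK₂ := hK₂ hM₂ hMg₂ hn₂ hgp₂ f₃ g₃ hf₃ hg₃
    have hK₂ := hK₂ hM₃ hMg₃ hn₃ hgp₃
    obtain ⟨εK', hεK', hK'ε⟩ := hK₂
    -- a common radius below the six bounds
    have hm : 0 < min (min (min ε₁ εP) (min εL εD)) (min εK εK') :=
      lt_min (lt_min (lt_min hε₁ hεP) (lt_min hεL hεD)) (lt_min hεK hεK')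
    have hε : 0 < min (min (min ε₁ εP) (min εL εD)) (min εK εK') / 2 := half_pos hm
    have hεm : min (min (min ε₁ εP) (min εL εD)) (min εK εK') / 2 < min (min (min ε₁ εP) (min εL εD)) (min εK εK') :=
      half_lt_self hm
    have h₁ := hεm.trans_le ((min_le_left _ _).trans ((min_le_left _ _).trans (min_le_left _ _)))
    have h₂ := hεm.trans_le ((min_le_left _ _).trans ((min_le_left _ _).trans (min_le_right _ _)))
    have h₃ := hεm.trans_le ((min_le_left _ _).trans ((min_le_right _ _).trans (min_le_left _ _)))
    have h₄ := hεm.trans_le ((min_le_left _ _).trans ((min_le_right _ _).trans (min_le_right _ _)))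
    have h₅ := hεm.trans_le ((min_le_right _ _).trans (min_le_left _ _))
    have h₆ := hεm.trans_le ((min_le_right _ _).trans (min_le_right _ _))
    have hGENε := hGENε _ hε h₁
    obtain ⟨s₁, s₂, s₃, β₁, β₂, β₃, ω₁, ω₂, ω₃, T₁, T₂, T₃, E, hs₁, hω₁, hs₂, hω₂, hs₃, hω₃, hT₁, hT₂, hT₃, hΓE, hE⟩ := hGENε
    have hPPε := hPPε _ hε h₂ s₁ β₁ ω₁
    have hPPε := hPPε hs₁ hω₁ T₁ hT₁
    obtain ⟨rP, c₁, hrP0, hc₁, hT₁eq⟩ := hPPε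
    -- parity of the Π-centre from `U_{rP}(c₁) ∈ Γ` commuting with `τ` (no Wall sign rule)
    have hτrP := eq_or_eq_neg_of_oneParamTransvection_comm hBn hτ2 hc₁ (r := rP) fun x => by
      simpa only [hT₁eq, oneParamTransvectionEquiv_apply, oneParamTransvection_apply] using hΓτ T₁ ⟨_, hT₁⟩ x
    have hPLε := hPLε _ hε h₃ s₂ β₂ ω₂
    have hPLε := hPLε hs₂ hω₂ T₂ hT₂
    obtain ⟨rL, c₂, hrL0, hc₂, hT₂eq⟩ := hPLε
    -- parity of the L-centre likewise
    have hτrL := eq_or_eq_neg_of_oneParamTransvection_comm hBn hτ2 hc₂ (r := rL) fun x => by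
      simpa only [hT₂eq, oneParamTransvectionEquiv_apply, oneParamTransvection_apply] using hΓτ T₂ ⟨_, hT₂⟩ x
    have hP2ε := hP2ε _ hε h₄ s₃ β₃ ω₃
    have hP2ε := hP2ε hs₃ hω₃ T₃ hT₃
    obtain ⟨δ₀, c₃, hδ0, hδ0', hc₃, hBδτ, hT₃eq⟩ := hP2ε
    have hKε := hKε _ _ hε h₅ hε h₅ s₁ β₁ ω₁
    have hKε := hKε hs₁ hω₁ s₃ β₃ ω₃
    have hKε := hKε hs₃ hω₃ T₁ hT₁ T₃ hT₃
    have hKε := hKε rP δ₀ c₁ c₃ hrP0 hδ0 hδ0' hτrP hBδτ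
    have hKε := hKε hT₁eq hT₃eq
    obtain ⟨gP, hgP, hlinkP⟩ := hKε
    have hK'ε := hK'ε _ _ hε h₆ hε h₆ s₂ β₂ ω₂
    have hK'ε := hK'ε hs₂ hω₂ s₃ β₃ ω₃
    have hK'ε := hK'ε hs₃ hω₃ T₂ hT₂ T₃ hT₃
    have hK'ε := hK'ε rL δ₀ c₂ c₃ hrL0 hδ0 hδ0' hτrL hBδτ
    have hK'ε := hK'ε hT₂eq hT₃eq
    obtain ⟨gL, hgL, hlinkL⟩ := hK'ε
    subst hT₁eq hT₂eq hT₃eq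
    -- v12d seam (FIB-coreC: `B = c · φ^*B_{X_f}`, `c ≠ 0` opaque): GEO's form is `c⁻¹ • B`, the transvection parameters become `cᵢ * c`
    have e₁ := oneParamTransvectionEquiv_inv_smul _ hrP0 hc c₁
    have e₂ := oneParamTransvectionEquiv_inv_smul _ hrL0 hc c₂
    have e₃ := oneParamTransvectionEquiv_inv_smul _ hδ0 hc c₃
    have e₃' := oneParamTransvectionEquiv_inv_smul _ hδ0' hc c₃
    simp only [← e₁, ← e₂, ← e₃, ← e₃'] at hT₁ hT₂ hT₃ hE
    refine ⟨φ, _, isAlt_smul_form (isAlt_tr_cup_of_odd hY ⟨1, by norm_num⟩) c⁻¹, nondegenerate_smul_form hBn (inv_ne_zero hc), _, hτ2,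
      rP, rL, δ₀, c₁ * c, c₂ * c, c₃ * c, E, ?_⟩
    intro Γ
    -- `H³ ≠ 0`: LINK gives `B rP (gP δ₀) ≠ 0`, so `rP ≠ 0`
    have hNon : Nontrivial (bettiCohomology (fiberOver (familyM ℂ 3 d {m : DegIndex 3 d | Even (m.1 0 + m.1 1)}) (classifyingPoint ℂ 3 d {m : DegIndex 3 d | Even (m.1 0 + m.1 1)} t₀ f)) 3) :=
      nontrivial_of_ne rP 0 fun h0 => hlinkP (by simp only [h0, map_zero, LinearMap.zero_apply])
    exact ⟨hNon, smul_form_invariant hτB c⁻¹, hφτ, inv_smul_form_eq hc hφB, hHG, hΓτ, smul_form_invariant_subgroup hΓB c⁻¹, hτrP, hτrL,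
      smul_form_apply_eq_zero hBδτ c⁻¹, mul_ne_zero hc₁ hc, mul_ne_zero hc₂ hc, mul_ne_zero hc₃ hc, ⟨_, hT₁⟩, ⟨_, hT₂⟩, ⟨_, hT₃⟩, hΓE, hE,
      hGIC', ⟨gP, hgP, inv_smul_form_apply_ne_zero hlinkP hc⟩, ⟨gL, hgL, inv_smul_form_apply_ne_zero hlinkL hc⟩⟩



/-! ### §2 The envelope on `familyM ℂ 3 d M_ι` with its base point exposed -/

open Literature.AlgebraicGeometry.Motives Literature.AlgebraicGeometry.Motives.UniversalHypersurface Literature.AlgebraicGeometry.HodgeTheory Literature.AlgebraicGeometry.HodgeTheory.UniversalHypersurface Literature.AlgebraicGeometry.HodgeTheory.BettiUniverse CategoryTheory.Limits in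
/-- **The sign-pencil ENVELOPE with fixed centres of unknown sign ON THE NAMED FAMILY** `familyM ℂ 3 d M_ι`, base point
exposed: verbatim `SignSymmetricPowersOrbitDataMono.signPencilEnvelope_mono` (same proof) over `signPencilOrbitData_mono_familyM`.
[cite: VoisinHodgeII2003, §6.1.3 Cor. 6.12 and §6.2.1] [cite: Shioda1979HodgeFermat, §1] -/
theorem signPencilEnvelope_mono_familyM (hZvK : Literature.AlgebraicGeometry.FundamentalGroup.affineHypersurfaceComplement_meridians_normalClosure_eq_top)
    (hD1 : Literature.AlgebraicGeometry.HodgeTheory.discriminant_localBranches_nodal) (hNC : ∀ (n d : ℕ) (f₁ g₀ g₂ : MvPolynomial (Fin (n + 2)) ℂ) (j k : Fin (n + 2)) (a : Fin (n + 2) → ℂˣ),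
      1 ≤ n → 1 ≤ d → Odd n → (∃ (i : Fin (n + 2)) (c : ℂ), g₀ = c • MvPolynomial.X i ^ d) →
      f₁.IsHomogeneous d → g₀.IsHomogeneous d → g₂.IsHomogeneous d → Literature.AlgebraicGeometry.HodgeTheory.IsSymmetricA3Datum f₁ g₀ g₂ j k a →
      ∀ (εa εb : ℝ) (ψ : ℂ → ℂ), Literature.AlgebraicGeometry.HodgeTheory.IsSymmetricA3Bifurcation f₁ g₀ g₂ j a εa εb ψ →
        ∃ εa' : ℝ, 0 < εa' ∧ εa' ≤ εa ∧ Literature.AlgebraicGeometry.HodgeTheory.SymmetricA3NonCommutation n d f₁ g₀ g₂ ψ εa')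
    (hMC : Literature.AlgebraicGeometry.FundamentalGroup.affineHypersurfaceComplement_meridian_isConj) :
    open Literature.AlgebraicGeometry.Motives Literature.AlgebraicGeometry.HodgeTheory Literature.AlgebraicGeometry.HodgeTheory.BettiUniverse CategoryTheory.Limits in ∀ ⦃d : ℕ⦄, Even d → 4 ≤ d → ∃ (_ : IrreducibleSpace (baseM ℂ 3 d {m : DegIndex 3 d | Even (m.1 0 + m.1 1)}).left) (hu : IsSmoothProjectiveFamily (familyM ℂ 3 d {m : DegIndex 3 d | Even (m.1 0 + m.1 1)}) 3) (hU : IsCohomologicallyLocallyTrivialOn (familyM ℂ 3 d {m : DegIndex 3 d | Even (m.1 0 + m.1 1)}) (Set.univ : Set (ComplexPoints (baseM ℂ 3 d {m : DegIndex 3 d | Even (m.1 0 + m.1 1)})))) (A : ∀ t : ComplexPoints (baseM ℂ 3 d {m : DegIndex 3 d | Even (m.1 0 + m.1 1)}), HodgeModel 3 (fiberOver (familyM ℂ 3 d {m : DegIndex 3 d | Even (m.1 0 + m.1 1)}) t)) (hA : ∀ t, (A t).IsHodgeSymmetric) (hfin : ∀ t : ComplexPoints (baseM ℂ 3 d {m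 : DegIndex 3 d | Even (m.1 0 + m.1 1)}), Module.Finite ℚ (bettiCohomology (fiberOver (familyM ℂ 3 d {m : DegIndex 3 d | Even (m.1 0 + m.1 1)}) t) 3)) (t₀ : ComplexPoints (baseM ℂ 3 d {m : DegIndex 3 d | Even (m.1 0 + m.1 1)})), (∀ f : MvPolynomial (Fin 5) ℂ, f.IsHomogeneous d → (∀ e : Fin 5 →₀ ℕ, ¬ Even (e 0 + e 1) → f.coeff e = 0) → SmoothHypersurface.IsNonsingularForm ℂ f → ∀ (hXF : IsSmoothProjective 3 (SmoothHypersurface.hypersurface f)) (ha : (fun i : Fin 5 => if (i : ℕ) < 2 then (-1 : ℂˣ) else 1) ∈ diagonalStabilizer f), ∃ (φ : bettiCohomology (fiberOver (familyM ℂ 3 d {m : DegIndex 3 d | Even (m.1 0 + m.1 1)}) ((classifyingPoint ℂ 3 d {m : DegIndex 3 d | Even (m.1 0 + m.1 1)} t₀ f))) 3 ≃ₗ[ℚ] bettiCohomology (SmoothHypersurface.hypersurface f) 3) (B : LinearMap.BilinForm ℚ (bettiCohomology (fiberOver (familyM ℂ 3 d {m : DegIndex 3 d | Even (m.1 0 +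 m.1 1)}) ((classifyingPoint ℂ 3 d {m : DegIndex 3 d | Even (m.1 0 + m.1 1)} t₀ f))) 3)) (hB : B.IsAlt) (_ : B.Nondegenerate) (τ : bettiCohomology (fiberOver (familyM ℂ 3 d {m : DegIndex 3 d | Even (m.1 0 + m.1 1)}) ((classifyingPoint ℂ 3 d {m : DegIndex 3 d | Even (m.1 0 + m.1 1)} t₀ f))) 3 →ₗ[ℚ] bettiCohomology (fiberOver (familyM ℂ 3 d {m : DegIndex 3 d | Even (m.1 0 + m.1 1)}) ((classifyingPoint ℂ 3 d {m : DegIndex 3 d | Even (m.1 0 + m.1 1)} t₀ f))) 3) (_ : τ ^ 2 = 1) (T D : Set (bettiCohomology (fiberOver (familyM ℂ 3 d {m : DegIndex 3 d | Even (m.1 0 + m.1 1)}) ((classifyingPoint ℂ 3 d {m : DegIndex 3 d | Even (m.1 0 + m.1 1)} t₀ f))) 3)), let Γ := (haveI := hfin ((classifyingPoint ℂ 3 d {m : DegIndex 3 d | Even (m.1 0 + m.1 1)} t₀ f)); ratMonodromyGroup (familyM ℂ 3 d {m : DegIndex 3 d | Even (m.1 0 + m.1 1)}) 3 hU ⟨(classifyingPoint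 ℂ 3 d {m : DegIndex 3 d | Even (m.1 0 + m.1 1)} t₀ f), Set.mem_univ _⟩); let RP : Set (bettiCohomology (fiberOver (familyM ℂ 3 d {m : DegIndex 3 d | Even (m.1 0 + m.1 1)}) ((classifyingPoint ℂ 3 d {m : DegIndex 3 d | Even (m.1 0 + m.1 1)} t₀ f))) 3) := {r ∈ T | τ r = r} ∪ (fun δ => δ + τ δ) '' D; let RN : Set (bettiCohomology (fiberOver (familyM ℂ 3 d {m : DegIndex 3 d | Even (m.1 0 + m.1 1)}) ((classifyingPoint ℂ 3 d {m : DegIndex 3 d | Even (m.1 0 + m.1 1)} t₀ f))) 3) := {r ∈ T | τ r = -r} ∪ (fun δ => δ - τ δ) '' D; Nontrivial (bettiCohomology (fiberOver (familyM ℂ 3 d {m : DegIndex 3 d | Even (m.1 0 + m.1 1)}) ((classifyingPoint ℂ 3 d {m : DegIndex 3 d | Even (m.1 0 + m.1 1)} t₀ f))) 3) ∧ (∀ x y, B (τ x) (τ y) = B x y) ∧ (∀ x, φ (τ x) = pull (diagonalAut f ha) 3 (φ x)) ∧ (∀ x y, B x y = tr hXF (3 + 3) (cup (SmoothHypersurface.hypersurface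 f) 3 3 (φ x) (φ y))) ∧ (haveI : HodgeTensorFacts.{0, 0} := hodgeTensorFacts_holds; haveI := finite hXF 3; haveI := hfin ((classifyingPoint ℂ 3 d {m : DegIndex 3 d | Even (m.1 0 + m.1 1)} t₀ f)); ∀ k : bettiCohomology (fiberOver (familyM ℂ 3 d {m : DegIndex 3 d | Even (m.1 0 + m.1 1)}) ((classifyingPoint ℂ 3 d {m : DegIndex 3 d | Even (m.1 0 + m.1 1)} t₀ f))) 3 ≃ₗ[ℚ] bettiCohomology (fiberOver (familyM ℂ 3 d {m : DegIndex 3 d | Even (m.1 0 + m.1 1)}) ((classifyingPoint ℂ 3 d {m : DegIndex 3 d | Even (m.1 0 + m.1 1)} t₀ f))) 3, k ∈ ((A ((classifyingPoint ℂ 3 d {m : DegIndex 3 d | Even (m.1 0 + m.1 1)} t₀ f))).hodgeStructure (hu.isSmoothProjective ((classifyingPoint ℂ 3 d {m : DegIndex 3 d | Even (m.1 0 + m.1 1)} t₀ f))) (hA ((classifyingPoint ℂ 3 d {m : DegIndex 3 d | Even (m.1 0 + m.1 1)} t₀ f))) 3).hodgeGroup → (φ.symm.trans k).trans φ ∈ (hodge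 exists_isReal_hodgeModel_holds hXF 3).hodgeGroup) ∧ (∀ r ∈ T, ∃ c : ℚ, c ≠ 0 ∧ oneParamTransvectionEquiv B (hB r) c ∈ Γ) ∧ (∀ δ ∈ D, B δ (τ δ) = 0 ∧ ∃ c : ℚ, c ≠ 0 ∧ oneParamTransvectionEquiv B (hB δ) c * oneParamTransvectionEquiv B (hB (τ δ)) c ∈ Γ) ∧ (∀ r ∈ T, τ r = r ∨ τ r = -r) ∧ (D.Nonempty → T.Nonempty) ∧ Submodule.span ℚ RP = Module.End.eigenspace τ 1 ∧ (∀ A' ⊆ RP, A'.Nonempty → A' ≠ RP → ∃ r ∈ A', ∃ ρ ∈ RP, ρ ∉ A' ∧ B r ρ ≠ 0) ∧ Submodule.span ℚ RN = Module.End.eigenspace τ (-1) ∧ (∀ A' ⊆ RN, A'.Nonempty → A' ≠ RN → ∃ r ∈ A', ∃ ρ ∈ RN, ρ ∉ A' ∧ B r ρ ≠ 0)) := by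
  intro d hd h4d
  obtain ⟨hirr, hu, hU, A, hA, hfin, t₀, hMEM⟩ := (signPencilOrbitData_mono_familyM hNC hMC hZvK
      (fun n d hd => Literature.AlgebraicGeometry.HodgeTheory.exists_irreducible_isHomogeneous_discriminantForm (n := n) (d := d) hd) hD1
      Summit.HodgeConjecture.HodgeConjecture.Theorems.SignSymmetricPowersNodalForms.stub_signNodalForms) hd h4d
  refine ⟨hirr, hu, hU, A, hA, hfin, t₀, ?_⟩
  intro f hf hev hJ hXF ha
  obtain ⟨φ, B, hB, hBn, τ, hτ, rP, rL, δ₀, c₁, c₂, c₃, E, hNon, hτB, hφτ, hφB, hHG, hΓτ, hΓB, hrP, hrL, hδ₀,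
    hc₁, hc₂, hc₃, huP, huL, huδ, hΓE, hE, hinv, hlinkP, hlinkL⟩ := hMEM f hf hev hJ hXF ha
  haveI := hfin (classifyingPoint ℂ 3 d {m : DegIndex 3 d | Even (m.1 0 + m.1 1)} t₀ f)
  -- both eigenspaces of `τ` are non-zero: Shioda's count on `X_f` (`exists_signEigenvector`), transported along `φ`
  have heig : ∀ j : ℕ, j < 2 → ∃ v : bettiCohomology (fiberOver (familyM ℂ 3 d {m : DegIndex 3 d | Even (m.1 0 + m.1 1)}) (classifyingPoint ℂ 3 d {m : DegIndex 3 d | Even (m.1 0 + m.1 1)} t₀ f)) 3, v ≠ 0 ∧ τ v = ((-1 : ℚ) ^ j) • v := by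
    intro j hj
    obtain ⟨y, hy0, hy⟩ := exists_signEigenvector hd h4d f hf hJ hXF ha hj
    refine ⟨φ.symm y, fun h0 => hy0 (by simpa using congrArg φ h0), φ.injective ?_⟩
    rw [hφτ, LinearEquiv.apply_symm_apply, map_smul, LinearEquiv.apply_symm_apply]
    exact hy
  have hVpos : ∃ v : bettiCohomology (fiberOver (familyM ℂ 3 d {m : DegIndex 3 d | Even (m.1 0 + m.1 1)}) (classifyingPoint ℂ 3 d {m : DegIndex 3 d | Even (m.1 0 + m.1 1)} t₀ f)) 3, v ≠ 0 ∧ τ v = v := by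
    obtain ⟨v, hv0, hv⟩ := heig 0 (by norm_num)
    exact ⟨v, hv0, by rw [hv, pow_zero, one_smul]⟩
  have hVneg : ∃ v : bettiCohomology (fiberOver (familyM ℂ 3 d {m : DegIndex 3 d | Even (m.1 0 + m.1 1)}) (classifyingPoint ℂ 3 d {m : DegIndex 3 d | Even (m.1 0 + m.1 1)} t₀ f)) 3, v ≠ 0 ∧ τ v = -v := by
    obtain ⟨v, hv0, hv⟩ := heig 1 (by norm_num)
    exact ⟨v, hv0, by rw [hv, pow_one, neg_one_smul]⟩
  obtain ⟨h6, h7, h8, h9, h10, h11, h12, h13⟩ :=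
    signPencil_clauses_of_orbitData_unsigned hB hBn (by norm_num) hτ hτB hΓτ hΓB hrP hrL hδ₀ hc₁ hc₂ hc₃ huP huL huδ hΓE hE
      hinv hlinkP hlinkL hVpos hVneg
  exact ⟨φ, B, hB, hBn, τ, hτ, _, _, hNon, hτB, hφτ, hφB, hHG, h6, h7, h8, h9, h10, h11, h12, h13⟩

/-! ### §3 The kernel: from `(Γ^Zar)⁰ ⊆ MT` at the classifying point of ONE member to the sign-deck model statement -/

open Literature.AlgebraicGeometry.Motives Literature.AlgebraicGeometry.Motives.UniversalHypersurface Literature.AlgebraicGeometry.HodgeTheory Literature.AlgebraicGeometry.HodgeTheory.UniversalHypersurface Literature.AlgebraicGeometry.HodgeTheory.BettiUniverse CategoryTheory.Limits in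
/-- **THE POINTWISE KERNEL of crux K1-B.**  Given the deck Hodge numbers (`hSDH`), the Zariski–van Kampen and nodal-branch
facts (tree theorems, passed as `hZvK`, `hD1`, `hMC`) and the keyed symmetric-`A₃` binder `hNC` (= hN′, `stub_a3NonCommOdd`):
for every even `d ≥ 4` there are Hodge-symmetric models `A` of the fibres of `familyM ℂ 3 d M_ι` and a base point `t₀` such
that for every smooth ι-even quinary form `f` of degree `d` whose classifying point `t = classifyingPoint t₀ f` satisfies
`(Γ_t^Zar)⁰ ⊆ MT(H³(𝒴_t))`, the model `X_f` with `σ = diagonalAut f` has `σ*² = 1`, `σ*` a cup-isometry, the sign-refined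
Hodge numbers `shn d j q`, and every commutator of two σ-commuting cup-isometries of `H³(X_f;ℚ)` in the Hodge group.  Proof =
`SignSymmetricPowersFourFactsSolo.veryGeneralSignCommutatorsInHg_of_signDeckHodge_solo` from its line `hΓ` on, over
`signPencilEnvelope_mono_familyM`.  CONDITIONAL on hN′; nothing here says HC ∕ HC_AV is proved.
[cite: VoisinHodgeII2003, §6.1.3 Thm. 6.10 and Cor. 6.12] [cite: Deligne1980, §4.4 (4.4.1)–(4.4.4^α)]
[cite: CarlsonMullerStachPeters2017, Lemma–Definition 15.3.7] -/
theorem signModel_of_identityComponent_le_mumfordTate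
    (hSDH : open Literature.AlgebraicGeometry.Motives Literature.AlgebraicGeometry.HodgeTheory Literature.AlgebraicGeometry.HodgeTheory.BettiUniverse CategoryTheory.Limits in let pmul2 : List (ℕ × ℕ) → List (ℕ × ℕ) → List (ℕ × ℕ) := fun a b => (List.range (a.length + b.length - 1)).map fun k => (((List.range (k + 1)).map fun i => (a.getD i (0, 0)).1 * (b.getD (k - i) (0, 0)).1 + (a.getD i (0, 0)).2 * (b.getD (k - i) (0, 0)).2).sum, ((List.range (k + 1)).map fun i => (a.getD i (0, 0)).1 * (b.getD (k - i) (0, 0)).2 + (a.getD i (0, 0)).2 * (b.getD (k - i) (0, 0)).1).sum); let fac : ℕ → Bool → List (ℕ × ℕ) := fun d odd => (List.range (d - 1)).map fun k => if odd ∧ ¬ Even k then (0, 1) else (1, 0); let shn : ℕ → ℕ → ℕ → ℕ := fun d j q => if (q + 1) * d < 5 then 0 else if j = 0 then (([fac d true, fac d false, fac d false, fac d false].foldl pmul2 (fac d true)).getD ((q + 1) * d - 5) (0, 0)).1 else (([fac d true, fac d false, fac d false, fac d false].foldl pmul2 (fac d true)).getD ((q + 1) * d - 5) (0, 0)).2;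 ∀ ⦃d : ℕ⦄, Even d → 4 ≤ d → ∀ f : MvPolynomial (Fin 5) ℂ, f.IsHomogeneous d → (∀ e : Fin 5 →₀ ℕ, ¬ Even (e 0 + e 1) → f.coeff e = 0) → SmoothHypersurface.IsNonsingularForm ℂ f → ∀ (hXF : IsSmoothProjective 3 (SmoothHypersurface.hypersurface f)) (ha : (fun i : Fin 5 => if (i : ℕ) < 2 then (-1 : ℂˣ) else 1) ∈ diagonalStabilizer f), ∀ j q : ℕ, j < 2 → q ≤ 3 → Module.finrank ℂ ↥(Module.End.eigenspace ((pull (diagonalAut f ha) 3).baseChange ℂ) ((-1 : ℂ) ^ j) ⊓ (hodge exists_isReal_hodgeModel_holds hXF 3).piece ((3 : ℤ) - q) q) = shn d j q)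
    (hZvK : Literature.AlgebraicGeometry.FundamentalGroup.affineHypersurfaceComplement_meridians_normalClosure_eq_top)
    (hD1 : Literature.AlgebraicGeometry.HodgeTheory.discriminant_localBranches_nodal)
    (hNC : ∀ (n d : ℕ) (f₁ g₀ g₂ : MvPolynomial (Fin (n + 2)) ℂ) (j k : Fin (n + 2)) (a : Fin (n + 2) → ℂˣ),
      1 ≤ n → 1 ≤ d → Odd n → (∃ (i : Fin (n + 2)) (c : ℂ), g₀ = c • MvPolynomial.X i ^ d) →
      f₁.IsHomogeneous d → g₀.IsHomogeneous d → g₂.IsHomogeneous d → Literature.AlgebraicGeometry.HodgeTheory.IsSymmetricA3Datum f₁ g₀ g₂ j k a →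
      ∀ (εa εb : ℝ) (ψ : ℂ → ℂ), Literature.AlgebraicGeometry.HodgeTheory.IsSymmetricA3Bifurcation f₁ g₀ g₂ j a εa εb ψ →
        ∃ εa' : ℝ, 0 < εa' ∧ εa' ≤ εa ∧ Literature.AlgebraicGeometry.HodgeTheory.SymmetricA3NonCommutation n d f₁ g₀ g₂ ψ εa')
    (hMC : Literature.AlgebraicGeometry.FundamentalGroup.affineHypersurfaceComplement_meridian_isConj) :
    open Literature.AlgebraicGeometry.Motives Literature.AlgebraicGeometry.Motives.UniversalHypersurface Literature.AlgebraicGeometry.HodgeTheory Literature.AlgebraicGeometry.HodgeTheory.UniversalHypersurface Literature.AlgebraicGeometry.HodgeTheory.BettiUniverse CategoryTheory.Limits in let pmul2 : List (ℕ × ℕ) → List (ℕ × ℕ) → List (ℕ × ℕ) := fun a b => (List.range (a.length + b.length - 1)).map fun k => (((List.range (k + 1)).map fun i => (a.getD i (0, 0)).1 * (b.getD (k - i) (0, 0)).1 + (a.getD i (0, 0)).2 * (b.getD (k - i) (0, 0)).2).sum, ((List.range (k + 1)).map fun i => (a.getD i (0, 0)).1 * (b.getD (k - i) (0, 0)).2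 + (a.getD i (0, 0)).2 * (b.getD (k - i) (0, 0)).1).sum); let fac : ℕ → Bool → List (ℕ × ℕ) := fun d odd => (List.range (d - 1)).map fun k => if odd ∧ ¬ Even k then (0, 1) else (1, 0); let shn : ℕ → ℕ → ℕ → ℕ := fun d j q => if (q + 1) * d < 5 then 0 else if j = 0 then (([fac d true, fac d false, fac d false, fac d false].foldl pmul2 (fac d true)).getD ((q + 1) * d - 5) (0, 0)).1 else (([fac d true, fac d false, fac d false, fac d false].foldl pmul2 (fac d true)).getD ((q + 1) * d - 5) (0, 0)).2; ∀ ⦃d : ℕ⦄, Even d → 4 ≤ d → ∃ (hu : IsSmoothProjectiveFamily (familyM ℂ 3 d {m : DegIndex 3 d | Even (m.1 0 + m.1 1)}) 3) (hU : IsCohomologicallyLocallyTrivialOn (familyM ℂ 3 d {m : DegIndex 3 d | Even (m.1 0 + m.1 1)}) (Set.univ : Set (ComplexPoints (baseM ℂ 3 d {m : DegIndex 3 d | Even (m.1 0 + m.1 1)})))) (A : ∀ t : ComplexPoints (baseM ℂ 3 d {m : DegIndex 3 d | Even (m.1 0 + m.1 1)}), HodgeModel 3 (fiberOver (familyM ℂ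 3 d {m : DegIndex 3 d | Even (m.1 0 + m.1 1)}) t)) (hA : ∀ t, (A t).IsHodgeSymmetric) (hfin : ∀ t : ComplexPoints (baseM ℂ 3 d {m : DegIndex 3 d | Even (m.1 0 + m.1 1)}), Module.Finite ℚ (bettiCohomology (fiberOver (familyM ℂ 3 d {m : DegIndex 3 d | Even (m.1 0 + m.1 1)}) t) 3)) (t₀ : ComplexPoints (baseM ℂ 3 d {m : DegIndex 3 d | Even (m.1 0 + m.1 1)})), ∀ f : MvPolynomial (Fin 5) ℂ, f.IsHomogeneous d → (∀ e : Fin 5 →₀ ℕ, ¬ Even (e 0 + e 1) → f.coeff e = 0) → SmoothHypersurface.IsNonsingularForm ℂ f → ∀ (hXF : IsSmoothProjective 3 (SmoothHypersurface.hypersurface f)) (ha : (fun i : Fin 5 => if (i : ℕ) < 2 then (-1 : ℂˣ) else 1) ∈ diagonalStabilizer f), (haveI : HodgeTensorFacts.{0, 0} := hodgeTensorFacts_holds; haveI := hfin (classifyingPoint ℂ 3 d {m : DegIndex 3 d | Even (m.1 0 + m.1 1)} t₀ f); glIdentityComponent (ratMonodromyGroup (familyM ℂ 3 d {m : DegIndex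 3 d | Even (m.1 0 + m.1 1)}) 3 hU ⟨(classifyingPoint ℂ 3 d {m : DegIndex 3 d | Even (m.1 0 + m.1 1)} t₀ f), Set.mem_univ _⟩) ⊆ (((A (classifyingPoint ℂ 3 d {m : DegIndex 3 d | Even (m.1 0 + m.1 1)} t₀ f)).hodgeStructure (hu.isSmoothProjective (classifyingPoint ℂ 3 d {m : DegIndex 3 d | Even (m.1 0 + m.1 1)} t₀ f)) (hA (classifyingPoint ℂ 3 d {m : DegIndex 3 d | Even (m.1 0 + m.1 1)} t₀ f)) 3).mumfordTateGroup : Set (bettiCohomology (fiberOver (familyM ℂ 3 d {m : DegIndex 3 d | Even (m.1 0 + m.1 1)}) (classifyingPoint ℂ 3 d {m : DegIndex 3 d | Even (m.1 0 + m.1 1)} t₀ f)) 3 ≃ₗ[ℚ] bettiCohomology (fiberOver (familyM ℂ 3 d {m : DegIndex 3 d | Even (m.1 0 + m.1 1)}) (classifyingPoint ℂ 3 d {m : DegIndex 3 d | Even (m.1 0 + m.1 1)} t₀ f)) 3))) → (pull (diagonalAut f ha) 3 ^ 2 = 1 ∧ (∀ x y, tr hXF (3 + 3) (cup (SmoothHypersurface.hypersurface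 f) 3 3 (pull (diagonalAut f ha) 3 x) (pull (diagonalAut f ha) 3 y)) = tr hXF (3 + 3) (cup (SmoothHypersurface.hypersurface f) 3 3 x y)) ∧ ∀ j q : ℕ, j < 2 → q ≤ 3 → Module.finrank ℂ ↥(Module.End.eigenspace ((pull (diagonalAut f ha) 3).baseChange ℂ) ((-1 : ℂ) ^ j) ⊓ (hodge exists_isReal_hodgeModel_holds hXF 3).piece ((3 : ℤ) - q) q) = shn d j q) ∧ (haveI := finite hXF 3; haveI : HodgeTensorFacts.{0, 0} := hodgeTensorFacts_holds; ∀ g h : bettiCohomology (SmoothHypersurface.hypersurface f) 3 ≃ₗ[ℚ] bettiCohomology (SmoothHypersurface.hypersurface f) 3, ((∀ x, g (pull (diagonalAut f ha) 3 x) = pull (diagonalAut f ha) 3 (g x)) ∧ ∀ x y, tr hXF (3 + 3) (cup (SmoothHypersurface.hypersurface f) 3 3 (g x) (g y)) = tr hXF (3 + 3) (cup (SmoothHypersurface.hypersurface f) 3 3 x y)) → ((∀ x, h (pull (diagonalAut f ha) 3 x) = pull (diagonalAut f ha) 3 (h x)) ∧ ∀ x y, tr hXF (3 + 3) (cup (SmoothHypersurface.hypersurface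 f) 3 3 (h x) (h y)) = tr hXF (3 + 3) (cup (SmoothHypersurface.hypersurface f) 3 3 x y)) → g * h * g⁻¹ * h⁻¹ ∈ (hodge exists_isReal_hodgeModel_holds hXF 3).hodgeGroup) := by
  intro pmul2 fac shn d hd h4d
  obtain ⟨hirr, hu, hU, A, hA, hfin, t₀, hMEM⟩ := signPencilEnvelope_mono_familyM hZvK hD1 hNC hMC hd h4d
  refine ⟨hu, hU, A, hA, hfin, t₀, fun f hf hev hJ hXF ha hΓ => ?_⟩
  haveI hHTF : HodgeTensorFacts.{0, 0} := hodgeTensorFacts_holds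
  haveI : ∀ t : ComplexPoints (baseM ℂ 3 d {m : DegIndex 3 d | Even (m.1 0 + m.1 1)}), Module.Finite ℚ (bettiCohomology (fiberOver (familyM ℂ 3 d {m : DegIndex 3 d | Even (m.1 0 + m.1 1)}) t) 3) := hfin
  -- Deck clauses: `σ_f^{*2} = 1` and `σ_f^*` a `tr ∘ cup` isometry (tree), and the deck Hodge numbers from `hSDH`
  obtain ⟨ha', h1, h2⟩ := exists_signDeckModel_clauses_one_two f hev hXF
  refine ⟨⟨h1, h2, hSDH hd h4d f hf hev hJ hXF ha'⟩, ?_⟩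
  intro g h hg hh
  obtain ⟨φ, B, hB, hBn, τ, hτ, T, D, hNon, hτB, hφτ, hφB, hHG, hT, hD, hTsign, hseed, hspanPos, hconnPos,
    hspanNeg, hconnNeg⟩ := hMEM f hf hev hJ hXF ha
  haveI := finite hXF 3
  haveI : Nontrivial (bettiCohomology (fiberOver (familyM ℂ 3 d {m : DegIndex 3 d | Even (m.1 0 + m.1 1)}) (classifyingPoint ℂ 3 d {m : DegIndex 3 d | Even (m.1 0 + m.1 1)} t₀ f)) 3) := hNon
  -- transport the two σ-centraliser isometries to the fibre
  have hστ : ∀ y, τ (φ.symm y) = φ.symm (pull (diagonalAut f ha) 3 y) := fun y => by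
    apply φ.injective
    rw [hφτ, LinearEquiv.apply_symm_apply, LinearEquiv.apply_symm_apply]
  have cenτ : ∀ k : bettiCohomology (SmoothHypersurface.hypersurface f) 3 ≃ₗ[ℚ] bettiCohomology (SmoothHypersurface.hypersurface f) 3,
      (∀ x, k (pull (diagonalAut f ha) 3 x) = pull (diagonalAut f ha) 3 (k x)) →
      ∀ x, ((φ.trans k).trans φ.symm) (τ x) = τ (((φ.trans k).trans φ.symm) x) := by
    intro k hk x
    simp only [LinearEquiv.trans_apply]
    rw [hφτ, hk, hστ]
  have cenB : ∀ k : bettiCohomology (SmoothHypersurface.hypersurface f) 3 ≃ₗ[ℚ] bettiCohomology (SmoothHypersurface.hypersurface f) 3,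
      (∀ x y, tr hXF (3 + 3) (cup (SmoothHypersurface.hypersurface f) 3 3 (k x) (k y)) = tr hXF (3 + 3) (cup (SmoothHypersurface.hypersurface f) 3 3 x y)) →
      ∀ x y, B (((φ.trans k).trans φ.symm) x) (((φ.trans k).trans φ.symm) y) = B x y := by
    intro k hk x y
    simp only [LinearEquiv.trans_apply]
    rw [hφB, LinearEquiv.apply_symm_apply, LinearEquiv.apply_symm_apply, hk, ← hφB]
  -- Theorem A's algebra with fixed centres of unknown sign (W-ELIM kernel): commutators of the sign-symmetric
  -- centraliser of the fibre lie in its Hodge group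
  have hcomm := commutator_mem_hodgeGroup_of_signSymmetric_of_eigenCentres
    ((A (classifyingPoint ℂ 3 d {m : DegIndex 3 d | Even (m.1 0 + m.1 1)} t₀ f)).hodgeStructure (hu.isSmoothProjective (classifyingPoint ℂ 3 d {m : DegIndex 3 d | Even (m.1 0 + m.1 1)} t₀ f)) (hA (classifyingPoint ℂ 3 d {m : DegIndex 3 d | Even (m.1 0 + m.1 1)} t₀ f)) 3)
    (smoothProjective_hodgeStructure_isPolarizable_holds (hu.isSmoothProjective (classifyingPoint ℂ 3 d {m : DegIndex 3 d | Even (m.1 0 + m.1 1)} t₀ f)) (A (classifyingPoint ℂ 3 d {m : DegIndex 3 d | Even (m.1 0 + m.1 1)} t₀ f)) (hA (classifyingPoint ℂ 3 d {m : DegIndex 3 d | Even (m.1 0 + m.1 1)} t₀ f)) 3)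
    ⟨1, by norm_num⟩ hB hBn hτ hτB hΓ hT hD hTsign hseed hspanPos hconnPos hspanNeg hconnNeg
    (cenτ g hg.1) (cenB g hg.2) (cenτ h hh.1) (cenB h hh.2)
  -- transport back to `H³(X_f;ℚ)` along `φ` (Hodge groups correspond)
  have hback := hHG _ hcomm
  have hid : (φ.symm.trans (((φ.trans g).trans φ.symm) * ((φ.trans h).trans φ.symm) *
      ((φ.trans g).trans φ.symm)⁻¹ * ((φ.trans h).trans φ.symm)⁻¹)).trans φ = g * h * g⁻¹ * h⁻¹ := by
    have hinv : ∀ k : bettiCohomology (SmoothHypersurface.hypersurface f) 3 ≃ₗ[ℚ] bettiCohomology (SmoothHypersurface.hypersurface f) 3,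
        ((φ.trans k).trans φ.symm)⁻¹ = (φ.trans k⁻¹).trans φ.symm := by
      intro k
      rw [inv_eq_iff_mul_eq_one]
      ext x
      simp
    rw [hinv, hinv]
    ext x
    simp
  rw [hid] at hback
  exact hback

end Summit.HodgeConjecture.HodgeConjecture.Theorems.SignSymmetricPowersPencilKernel

end
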